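import Summits.Ventures.PercRepro.S1CoreSplit
import Summits.Ventures.PercRepro.S1CoreDelete
import Summits.Ventures.PercRepro.RankLevelSetCircuitCount

/-!
# PercRepro — the 4-circuit deletion recursion with an arbitrary per-point bound (p3 g21; feeder for S1 row 12)

p1's LEMMA T4⁺ (`S1CoreFourCircuitSum.ncard_fourCircuits_le_fourCircuitBound`) is the deletion recursion
`s₄(M) ≤ #4circ(e) + s₄(M ＼ {e})` (`S1CoreSplit`) on the e-free core (closed under deletion, `S1CoreDelete`; the
nullity drops by one at a non-coloop), fed with the per-point bound `perPointBound`.  This file states the recursion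
for ANY per-point bound `q : ℕ → ℕ`: if every e-free core of nullity `j` has at most `q j` four-circuits through
each of its points, then an e-free core of nullity `d` has at most `Σ_{j ≤ d} q j` four-circuits.  With `q = Q*`
(the 4-circuit cap of `P1-S4-PERPOINT.md` §9, a computed table) this is `s₄ ≤ Σ_{j ≤ ν} Q*(j)`.

* **`ncard_fourCircuits_le_sum_of_perPoint`** — the recursion.
Axioms: standard.
-/

open scoped Matroid

namespace PercRepro

namespace FourCircuitCap

open Set

variable {α : Type}

/-- **The deletion recursion with a per-point bound `q`.** If every e-free core `M'` (on the same type) of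
nullity `j` has `#4circ_{M'}(e) ≤ q j` at every point `e`, then an e-free core of nullity `d` has at most
`Σ_{j ≤ d} q j` four-circuits. -/
theorem ncard_fourCircuits_le_sum_of_perPoint (q : ℕ → ℕ)
    (hq : ∀ (M' : Matroid α) [M'.Finite],
      (∀ e ∈ M'.E, ∃ A ⊆ M'.E \ {e}, e ∉ M'.closure A ∧ e ∉ M'.closure ((M'.E \ {e}) \ A)) →
      ∀ j : ℕ, M'.E.encard = M'.eRank + j → ∀ e ∈ M'.E,
      {C : Set α | M'.IsCircuit C ∧ C.ncard = 4 ∧ e ∈ C}.ncard ≤ q j)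
    (M : Matroid α) [M.Finite]
    (hfree : ∀ e ∈ M.E, ∃ A ⊆ M.E \ {e}, e ∉ M.closure A ∧ e ∉ M.closure ((M.E \ {e}) \ A))
    {d : ℕ} (hd : M.E.encard = M.eRank + d) :
    {C : Set α | M.IsCircuit C ∧ C.ncard = 4}.ncard ≤ (Finset.range (d + 1)).sum q := by
  suffices H : ∀ n : ℕ, ∀ (M : Matroid α) [M.Finite], M.E.ncard = n →
      (∀ e ∈ M.E, ∃ A ⊆ M.E \ {e}, e ∉ M.closure A ∧ e ∉ M.closure ((M.E \ {e}) \ A)) →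
      ∀ d : ℕ, M.E.encard = M.eRank + d →
      {C : Set α | M.IsCircuit C ∧ C.ncard = 4}.ncard ≤ (Finset.range (d + 1)).sum q from
    H _ M rfl hfree d hd
  intro n
  induction n using Nat.strong_induction_on with
  | _ n ih =>
  intro M _ hn hfree d hd
  classical
  set S := {C : Set α | M.IsCircuit C ∧ C.ncard = 4} with hS
  by_cases hSe : S = ∅
  · rw [hSe, ncard_empty]; exact Nat.zero_le _
  obtain ⟨C₀, hC₀⟩ := nonempty_iff_ne_empty.2 hSe
  obtain ⟨e, heC₀⟩ := hC₀.1.nonempty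
  have heE : e ∈ M.E := hC₀.1.subset_ground heC₀
  have hne : ¬ M.IsColoop e := hC₀.1.not_isColoop_of_mem heC₀
  have hν : M✶.eRank = (d : ℕ∞) := by
    have h := _root_.Matroid.eRank_add_eRank_dual M
    rw [hd] at h
    exact WithTop.add_left_cancel (PercRepro.Matroid.eRank_ne_top_of_finite M) h
  have hdel := PercRepro.Matroid.dual_eRank_delete_singleton_add_one heE hne
  rw [hν] at hdel
  have hfin' : (M ＼ {e})✶.eRank ≠ ⊤ := by
    intro h
    rw [h] at hdel
    exact absurd hdel (by simp)
  obtain ⟨d', hd'⟩ := ENat.ne_top_iff_exists.1 hfin'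
  have hdd' : d = d' + 1 := by
    rw [← hd'] at hdel
    exact_mod_cast hdel.symm
  have hd'enc : (M ＼ {e}).E.encard = (M ＼ {e}).eRank + d' := by
    have h := _root_.Matroid.eRank_add_eRank_dual (M ＼ {e})
    rw [← hd'] at h
    exact h.symm
  have hdelE : (M ＼ {e}).E.ncard < n := by
    rw [_root_.Matroid.delete_ground, ← hn, ← ncard_sdiff_singleton_add_one heE M.ground_finite]
    omega
  have hfree' := S1.hfree_delete M hfree e
  have hsplit := S1.ncard_fourCircuits_le_through_add_delete M e
  rw [← hS] at hsplit
  have h1 := hq M hfree d hd e heE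
  have h2 := ih _ hdelE (M ＼ {e}) rfl hfree' d' hd'enc
  subst hdd'
  rw [Finset.sum_range_succ]
  have h2' : {C : Set α | (M ＼ {e}).IsCircuit C ∧ C.ncard = 4}.ncard ≤ ∑ x ∈ Finset.range (d' + 1), q x := h2
  omega

end FourCircuitCap

end PercRepro
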